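import Literature.Computability.Complexity.SymmetricCircuitCompose
import Summits.PneNP.PneNP.Theorems.WindowBarrier.Negative.BudgetZero

/-!
# `NoHiddenOrder` (stmt-PneNP-14781) — the positive landing pad: a symmetric canoniser of the
# GRAPH in the window proves the crux (canonise-then-compute)

Route `PneNP/SymmetryBudget`, crux rank 4 (`Summit.PneNP.PneNP.Theses.SymmetryBudget.NoHiddenOrder`:
every `L ∈ P` with `Bud(m,⌊log₂ m⌋)`-invariant graph slices has, for one polynomial and all large `m`,
`Bud(m,⌊log₂ m⌋)`-symmetric threshold circuits of that size for its slices). Sorry-free; no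
definitions, no Literature facts; supports the item, does not close it.

What is proved. `hasSymSlices_of_graphCanonisation`: fix a budget `g : ℕ → ℕ` and a polynomial `q`,
and suppose that for all large `m` there are a well-formed gate list `gs` over `tcBasis` with
`|gs| ≤ q m`, designated wires `out q₀` (`q₀ : Fin m × Fin m`) and a matrix map `CF` such that
(i) `SymFix (Bud(m, g m)) gs (range out)` — every `ρ` in the budget extends to an automorphism of the
program FIXING every designated wire (`Literature/…/SymmetricCircuitCompose.lean`); (ii) the wire
`out q₀` carries `CF x q₀`; (iii′) the GRAPH of `CF x` is the graph of some `Bud(m, g m)`-relabelling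
of `x`: `Gr (CF x) = Gr (x ∘ (ρ × ρ))`, `Gr y = SimpleGraph.fromRel (y · · = true)`. Then EVERY `L ∈ P`
whose graph slices are `Bud(·, g ·)`-invariant has, for the polynomial `q + r_L` and all large `m`, a
`Bud(m, g m)`-symmetric threshold circuit of that size computing its slice: plug the `P ⊆ P/poly`
circuit of the slice (`slice_circuit_of_mem_P`, landed `Negative/BudgetZero.lean`) onto the fixed wires
(`SymFix.plug_general`, `SymFix.isSymmetricUnder_toCircuit`), evaluate (`vals_append_reloc`,
`wireOf_shiftWire`), rewrite the graph by (iii′) and use invariance once. At `g = ⌊log₂ ·⌋` this is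
the route decl verbatim (its inline `Sym`/`HasSym`/`Bud`/`Gr` unfold definitionally to
`IsSymmetricUnder`/`HasSymCircuit`/`pointStabiliserBudget`/`fromRel`): `noHiddenOrder_of_graphCanonisation`,
and the matrix-level special case (iii) `CF x = x ∘ (ρ × ρ)` — the `SymCanonisation` object of the
sibling crux's disproof workfile (Cruxes/WindowBarrier/Disproof.lean §Cycle2b) —
`noHiddenOrder_of_symCanonisation`.

Why the graph-level clause (iii′). The slices depend on `x` only through the simple graph `Gr x`
(symmetrised, loops dropped), so a canoniser need only output SOME matrix whose graph is the graph of
a `Bud`-relabelling of `x` — e.g. the symmetric loop-free adjacency matrix of a canonical copy of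
`Gr x`. This is the form every proposed construction produces (deck-DP over the subsets of the free
part, crux cards `kelly-ulam-deck-interface` / `deck-reconstruction-dp`; subset discretisation +
symmetric Weisfeiler–Leman), and the natural one: the raw matrix `x` is a loop/direction-decorated
digraph, for which deck reconstruction is false (Stockmeyer's tournaments), while the slices never
see the decoration. The hypothesis is stated `∀ᶠ m in atTop` (small `m` are irrelevant to the
`∃ p ∀ᶠ m` conclusion) and INLINE over the tree predicate `SymFix`, so a construction discharges it
verbatim.

What this file does NOT do: construct the canoniser. That is the open content of the crux ("window
canonisation": a `Bud(m,⌊log₂ m⌋)`-symmetric, `poly(m) = 2^{O(g)}`-size canoniser of the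
`g = ⌊log₂ m⌋` free vertices relative to the ordered part); it follows from the Kelly–Ulam
Reconstruction Conjecture by the deck-DP (crux cards, conditional), no unconditional technique is
known, and its failure for every `q` is `WindowBarrier` (stmt-PneNP-2145, `NoHiddenOrder ↔ ¬ WindowBarrier`
landed in `SymmetryBudgetNoHiddenOrderIffNotWindowBarrier.lean`).
-/

set_option linter.dupNamespace false -- `Summit.PneNP.PneNP.…`: summit = sub-problem name (D-0017 single-conjunct layout)

namespace Summit.PneNP.PneNP.Theorems

open scoped Classical
open Filter Literature.Computability.Complexity Literature.Computability.Complexity.GateList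
open Summit.PneNP.PneNP.Theses.SymmetryBudget
open Summit.PneNP.WindowBarrier.Negative

/-- **Canonise, then compute: a symmetric graph-canoniser at budget `g` compiles every invariant
`P`-slice into `Bud`-symmetric threshold circuits at budget `g`.** Hypothesis (inline, for all large
`m`): a well-formed `tcBasis` gate list `gs` with `|gs| ≤ q m`, designated wires `out q₀` and a map
`CF` with (i) `SymFix (Bud(m, g m)) gs (range out)`, (ii) the wire `out q₀` carries `CF x q₀`,
(iii′) `Gr (CF x) = Gr (x ∘ (ρ × ρ))` for some `ρ ∈ Bud(m, g m)`. Conclusion: every `L ∈ P` with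
`Bud(·, g ·)`-invariant graph slices has, for the polynomial `q + r` (`r` from `P ⊆ P/poly`) and all
large `m`, a `Bud(m, g m)`-symmetric `tcBasis` circuit of size `≤ (q + r) m` computing its `m`-th
slice. Proof: plug the slice circuit onto the fixed wires (`SymFix.plug_general`), read it off
(`SymFix.isSymmetricUnder_toCircuit`), evaluate, rewrite by (iii′), use invariance. [folklore] -/
theorem hasSymSlices_of_graphCanonisation (g : ℕ → ℕ) (q : Polynomial ℕ)
    (hcan : ∀ᶠ m : ℕ in atTop,
      ∃ (gs : List (Gate (Fin m × Fin m))) (out : Fin m × Fin m → (Fin m × Fin m) ⊕ ℕ)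
        (CF : (Fin m × Fin m → Bool) → (Fin m × Fin m → Bool)),
        WF gs ∧ (∀ gt ∈ gs, gt.fn ∈ tcBasis) ∧ gs.length ≤ q.eval m ∧
        SymFix (pointStabiliserBudget m (g m)) gs (Set.range out) ∧
        (∀ x q₀, wireOf x (vals gs x) (out q₀) = CF x q₀) ∧
        (∀ x, ∃ ρ ∈ pointStabiliserBudget m (g m),
          (SimpleGraph.fromRel fun u v => CF x (u, v) = true) =
            SimpleGraph.fromRel fun u v => x (ρ u, ρ v) = true))
    {L : _root_.Language Bool} (hL : L ∈ Classes.P)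
    (hinv : ∀ (m : ℕ), ∀ ρ ∈ pointStabiliserBudget m (g m), ∀ x : Fin m × Fin m → Bool,
      (encodingGraph.encode ⟨m, SimpleGraph.fromRel fun u v =>
          (fun q : Fin m × Fin m => x (ρ q.1, ρ q.2)) (u, v) = true⟩ ∈ L ↔
        encodingGraph.encode ⟨m, (SimpleGraph.fromRel fun u v => x (u, v) = true)⟩ ∈ L)) :
    ∃ p : Polynomial ℕ, ∀ᶠ m in atTop,
      HasSymCircuit tcBasis (pointStabiliserBudget m (g m)) (p.eval m)
        (fun x : Fin m × Fin m → Bool =>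
          decide (encodingGraph.encode ⟨m, (SimpleGraph.fromRel fun u v => x (u, v) = true)⟩ ∈ L)) := by
  obtain ⟨r, hr⟩ := slice_circuit_of_mem_P hL
  refine ⟨q + r, ((eventually_ge_atTop 1).and hcan).mono fun m hm => ?_⟩
  obtain ⟨hm, gs, out, CF, hwf, hB, hlen, hSF, hsem, hcf⟩ := hm
  obtain ⟨D, hDB, hDs, hDcomp⟩ := hr m hm
  -- plug the slice circuit `D` onto the fixed wires `out`
  have hOK : WiresOK gs.length out := fun k n hn => hSF.1 (out k) (Set.mem_range_self k) n hn
  have hSF' := hSF.plug_general hwf D (ρD := out) fun k => Set.mem_range_self k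
  have hwf' : WF (plug gs out D).1 := hwf.append_reloc (wf_gates D) hOK
  have hmem : (plug gs out D).2 ∈ Set.range out ∪ {(plug gs out D).2} :=
    Set.mem_union_right _ (Set.mem_singleton _)
  refine ⟨toCircuit (plug gs out D).1 (plug gs out D).2 hwf' (hSF'.1 _ hmem), ?_, ?_, ?_, ?_⟩
  · -- basis
    intro gt hgt
    change gt ∈ gs ++ D.gates.map (reloc out gs.length) at hgt
    rw [List.mem_append, List.mem_map] at hgt
    rcases hgt with hgt | ⟨g', hg', rfl⟩
    · exact hB gt hgt
    · rw [reloc_fn]; exact hDB g' hg'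
  · -- size
    change (plug gs out D).1.length ≤ (q + r).eval m
    rw [length_plug, Polynomial.eval_add]
    have : D.size ≤ r.eval m := hDs
    omega
  · -- symmetry
    exact hSF'.isSymmetricUnder_toCircuit hmem hwf'
  · -- semantics
    intro x
    rw [circuit_eval]
    change wireOf x (vals (gs ++ D.gates.map (reloc out gs.length)) x)
        (shiftWire out gs.length D.output) = _
    rw [vals_append_reloc gs D.gates out hOK x,
      wireOf_shiftWire x _ _ (length_vals gs x) out hOK, ← circuit_eval]
    have hx : (fun i => wireOf x (vals gs x) (out i)) = CF x := funext (hsem x)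
    obtain ⟨ρ, hρ, hρx⟩ := hcf x
    rw [hx, hDcomp]
    dsimp only
    rw [hρx]
    exact (decide_eq_decide).2 (hinv m ρ hρ x)

/-- **A symmetric graph-canoniser in the window proves `NoHiddenOrder`** (item stmt-PneNP-14781):
`hasSymSlices_of_graphCanonisation` at the budget `⌊log₂ m⌋` is the route decl verbatim (its inline
`Sym`/`HasSym`/`Bud`/`Gr` unfold definitionally). This is the exact landing pad for every positive line
on the crux: it remains to build, for all large `m`, a `poly(m)`-size `Bud(m,⌊log₂ m⌋)`-symmetric
multi-output threshold program whose fixed wires carry a matrix with the graph of a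
`Bud`-relabelling of the input ("window canonisation"). [folklore] -/
theorem noHiddenOrder_of_graphCanonisation (q : Polynomial ℕ)
    (hcan : ∀ᶠ m : ℕ in atTop,
      ∃ (gs : List (Gate (Fin m × Fin m))) (out : Fin m × Fin m → (Fin m × Fin m) ⊕ ℕ)
        (CF : (Fin m × Fin m → Bool) → (Fin m × Fin m → Bool)),
        WF gs ∧ (∀ gt ∈ gs, gt.fn ∈ tcBasis) ∧ gs.length ≤ q.eval m ∧
        SymFix (pointStabiliserBudget m (Nat.log 2 m)) gs (Set.range out) ∧
        (∀ x q₀, wireOf x (vals gs x) (out q₀) = CF x q₀) ∧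
        (∀ x, ∃ ρ ∈ pointStabiliserBudget m (Nat.log 2 m),
          (SimpleGraph.fromRel fun u v => CF x (u, v) = true) =
            SimpleGraph.fromRel fun u v => x (ρ u, ρ v) = true)) :
    NoHiddenOrder := by
  intro L hL hinv
  exact hasSymSlices_of_graphCanonisation (Nat.log 2) q hcan hL hinv

/-- **Matrix-level special case** (the `SymCanonisation (Nat.log 2) q` object of the sibling crux's
disproof workfile, clause (iii) `CF x = x ∘ (ρ × ρ)` pointwise, here over `SymFix`): a
`Bud(m,⌊log₂ m⌋)`-symmetric poly-size canoniser of the input MATRIX under the budget's conjugation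
action proves `NoHiddenOrder`. Immediate from `noHiddenOrder_of_graphCanonisation`, since equal
matrices have equal graphs. [folklore] -/
theorem noHiddenOrder_of_symCanonisation (q : Polynomial ℕ)
    (hcan : ∀ᶠ m : ℕ in atTop,
      ∃ (gs : List (Gate (Fin m × Fin m))) (out : Fin m × Fin m → (Fin m × Fin m) ⊕ ℕ)
        (CF : (Fin m × Fin m → Bool) → (Fin m × Fin m → Bool)),
        WF gs ∧ (∀ gt ∈ gs, gt.fn ∈ tcBasis) ∧ gs.length ≤ q.eval m ∧
        SymFix (pointStabiliserBudget m (Nat.log 2 m)) gs (Set.range out) ∧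
        (∀ x q₀, wireOf x (vals gs x) (out q₀) = CF x q₀) ∧
        (∀ x, ∃ ρ ∈ pointStabiliserBudget m (Nat.log 2 m), ∀ q₀, CF x q₀ = x (ρ q₀.1, ρ q₀.2))) :
    NoHiddenOrder := by
  refine noHiddenOrder_of_graphCanonisation q (hcan.mono fun m hm => ?_)
  obtain ⟨gs, out, CF, hwf, hB, hlen, hSF, hsem, hcf⟩ := hm
  refine ⟨gs, out, CF, hwf, hB, hlen, hSF, hsem, fun x => ?_⟩
  obtain ⟨ρ, hρ, hρx⟩ := hcf x
  refine ⟨ρ, hρ, ?_⟩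
  have : CF x = fun q₀ => x (ρ q₀.1, ρ q₀.2) := funext hρx
  rw [this]

/-- **Entry-wise form of the landing pad** (the socket for constructions that deliver the
canoniser one output bit at a time, e.g. as compiled `GateDAG`s via
`GateDAG.isSymmetricUnder_compile_iff`, the way the tree's Held–Karp and `HamCompiles` circuits are
delivered): if, for one polynomial `q` and all large `m`, there is a matrix map `CF` such that EVERY
entry `x ↦ CF x q₀` has a `Bud(m,⌊log₂ m⌋)`-symmetric `tcBasis` circuit of size `≤ q m`, and the graph
of `CF x` is the graph of a `Bud`-relabelling of `x`, then `NoHiddenOrder`. Proof: lay the `m²`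
symmetric circuits side by side (`GateList.symLayer`: every output becomes an automorphism-FIXED
wire, `symFix_symLayer`; semantics `carries_symLayer`; `≤ m²·q m` gates, `length_symLayer_fst`) and
apply `noHiddenOrder_of_graphCanonisation` with the polynomial `X² · q`. [folklore] -/
theorem noHiddenOrder_of_entrywiseCanoniser (q : Polynomial ℕ)
    (hcan : ∀ᶠ m : ℕ in atTop, ∃ CF : (Fin m × Fin m → Bool) → (Fin m × Fin m → Bool),
      (∀ q₀ : Fin m × Fin m,
        HasSymCircuit tcBasis (pointStabiliserBudget m (Nat.log 2 m)) (q.eval m) fun x => CF x q₀) ∧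
      (∀ x, ∃ ρ ∈ pointStabiliserBudget m (Nat.log 2 m),
        (SimpleGraph.fromRel fun u v => CF x (u, v) = true) =
          SimpleGraph.fromRel fun u v => x (ρ u, ρ v) = true)) :
    NoHiddenOrder := by
  refine noHiddenOrder_of_graphCanonisation (Polynomial.X ^ 2 * q) (hcan.mono fun m hm => ?_)
  obtain ⟨CF, hC, hgr⟩ := hm
  choose C hCB hCs hCS hCf using hC
  -- enumerate the entries and lay the `m²` circuits side by side
  let e : Fin (m * m) ≃ Fin m × Fin m := finProdFinEquiv.symm
  let Cs : List (Circuit (Fin m × Fin m)) := List.ofFn fun k => C (e k)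
  have hlenC : Cs.length = m * m := List.length_ofFn
  set L := symLayer Cs with hL
  have hlen2 : L.2.length = m * m := by rw [hL, length_symLayer_snd, hlenC]
  let out : Fin m × Fin m → (Fin m × Fin m) ⊕ ℕ := fun q₀ => L.2[e.symm q₀]'(by rw [hlen2]; exact (e.symm q₀).2)
  have hout_mem : ∀ q₀, out q₀ ∈ {w | w ∈ L.2} := fun q₀ => List.getElem_mem _
  have hmemCs : ∀ C' ∈ Cs, ∃ k, C' = C (e k) := fun C' hC' => by
    obtain ⟨k, rfl⟩ := List.mem_ofFn.1 hC'
    exact ⟨k, rfl⟩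
  refine ⟨L.1, out, CF, wf_symLayer Cs, ?_, ?_, ?_, ?_, hgr⟩
  · -- basis
    refine fn_mem_symLayer Cs fun C' hC' => ?_
    obtain ⟨k, rfl⟩ := hmemCs C' hC'
    exact hCB _
  · -- size `Σ |C q₀| ≤ m² · q m = (X² · q) m`
    rw [hL, length_symLayer_fst, Polynomial.eval_mul, Polynomial.eval_pow, Polynomial.eval_X]
    have : (Cs.map Circuit.size).sum ≤ (Cs.map Circuit.size).length * q.eval m := by
      refine List.sum_le_card_nsmul _ _ fun s hs => ?_
      obtain ⟨C', hC', rfl⟩ := List.mem_map.1 hs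
      obtain ⟨k, rfl⟩ := hmemCs C' hC'
      exact hCs _
    rw [List.length_map, hlenC] at this
    simpa [sq] using this
  · -- symmetry: every laid-out output is a fixed wire
    refine (symFix_symLayer Cs fun C' hC' => ?_).mono ?_
    · obtain ⟨k, rfl⟩ := hmemCs C' hC'
      exact hCS _
    · rintro w ⟨q₀, rfl⟩
      exact hout_mem q₀
  · -- semantics: the wire `out q₀` carries `CF · q₀`
    intro x q₀
    have hk : ((e.symm q₀ : Fin (m * m)) : ℕ) < Cs.length := by rw [hlenC]; exact (e.symm q₀).2
    have hcar := carries_symLayer Cs (e.symm q₀) hk (by rw [hlen2]; exact (e.symm q₀).2)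
    have hCk : Cs[((e.symm q₀ : Fin (m * m)) : ℕ)]'hk = C (e (e.symm q₀)) := by
      simp [Cs]
    rw [hCk, Equiv.apply_symm_apply] at hcar
    exact (hcar.eval x).trans (hCf q₀ x)

end Summit.PneNP.PneNP.Theorems
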